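import Mathlib

/-!
# Hodge-locus census — THEOREM K-MODEL, `c′ = 1`: the model member is a NON-jump member for `k′ = 3, 4` (finite `d`) and for `k′ = 3`, ALL `d ≥ 5`
(def-free, computable helper of `stmt-HodgeConjecture-16267`; pub-hlocus, seat ivhs-2 = ENGINE B, gen 31; record `pub-hlocus-ivhs-2/ENGINEB-g31.md`
§11 THEOREM K-MODEL / §15; companions: `HodgeLocusCensusModelJumpFamily.lean` (the exceptional `k′ = 2` jump family) and
`HodgeLocusCensusModelJumpWitness.lean` (the K-GEN witness).)

Setting (record §8, §11): in the cell `(2k′, d, k′-1)` (`c′ = 1`: the two coordinate `k′-1`-planes of the model member `F_{d;1,k′}` meet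
in codimension one) the plane algebra is `B = K[x_1..x_{k′}]/(x_1^{d-1}, …, x_{k′}^{d-1})`, the restricted transition form is
`δ = Σ_i x_i^{d-2}`, and the Kronecker index is `ρ = rank(×δ : B_{s-d} → B_{t-d})` with `s - d = k′(d-2) - d`, `t - d = k′(d-2) - 2`;
the member is a non-jump member iff `ρ = H_min = min(H_B(d), H_B(t-d))`.  In the monomial bases the column of `x^m` is the list of the
surviving products `x_i^{d-2}x^m` (`m_i + d - 2 ≤ d - 2`, i.e. `m_i = 0`), each with coefficient `1` (`suppMulL`).

KERNEL-CHECKED HERE.  (1) `covered_table`/`tdim_table` (`decide`, `k′ ∈ {3,4}`, `d = 5..8`): every basis monomial of `B_{t-d}` occurs as a column that is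
exactly that unit vector, every column is a unit vector or zero, and `dim B_{t-d} = k′(k′+1)/2`; hence (paper step) `ρ = dim B_{t-d} = H_B(t-d) ≥ H_min`, so
`ρ = H_min`: NON-jump, as THEOREM K-MODEL asserts off the exceptional family.  (2) `k2_table`: for `k′ = 2`, `d = 5..9` the target is NOT covered (the jump family of
the companion file for `d ≥ 6`; at `d = 5` `H_min = H_B(d) = 2` is attained anyway).  (3) ALL `d`, `k′ = 3` (cells `(6,d,2)`): `suppMulL_zero_first/second/third`
— a source monomial with exactly one zero exponent has the unit column obtained by raising that exponent to `d-2`; `suppMulL_nozero` — no zero exponent ⇒ zero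
column; `source_target_shape` (`omega`, `d ≥ 5`) — a source monomial has at most one zero exponent (the others are then `≥ d-4 ≥ 1`), and every target monomial has
an exponent equal to `d-2` with the other two `≥ 1`.  Together: every target monomial `v` (say `v_i = d-2`) is the unit column of the source monomial `v - (d-2)e_i`,
all other columns vanish, so `ρ(F_{d;1,3}) = dim B_{3d-8} = 6 = H_min` for EVERY `d ≥ 5` — the cells `(6,d,2)` carry no model jump for any `d` (census: GK652/662/672
non-jump, K-OK), complementing the all-`d` jump family `(4,d,1)`.  The rank conclusion itself is the one-line paper step named above (not re-proved here).

certified instances and evidence bearing on the general Hodge conjecture; no claim.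
-/

set_option maxRecDepth 200000
set_option maxHeartbeats 8000000

namespace Summit.HodgeConjecture.HodgeConjecture.HodgeLocus.Census.ModelNonJumpC1

/-- exponent vectors of length `k`, entries `≤ d-2`, total degree `n`: the monomial basis of `B_n`,
`B = K[x_1..x_k]/(x_1^{d-1}, …, x_k^{d-1})` -/
def basisL (d : ℕ) : ℕ → ℕ → List (List ℕ)
  | 0, n => if n = 0 then [[]] else []
  | k + 1, n => (List.range (min n (d - 2) + 1)).flatMap (fun i => (basisL d k (n - i)).map (List.cons i))

/-- support of `x^m · δ` in `B`, `δ = Σ_i x_i^{d-2}` (model member, `c′ = 1`): `x_i^{d-2} x^m` survives iff `m_i + (d-2) ≤ d-2` -/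
def suppMulL (d : ℕ) (m : List ℕ) : List (List ℕ) :=
  (List.range m.length).filterMap (fun i => if m.getD i 0 + (d - 2) ≤ d - 2 then some (m.set i (m.getD i 0 + (d - 2))) else none)

/-- `c′ = 1`, `k′ = k` variables on `𝕃`: source degree `s - d = k(d-2) - d`, target degree `t - d = k(d-2) - 2` -/
def sdeg (d k : ℕ) : ℕ := k * (d - 2) - d
/-- target degree `t - d = k(d-2) - 2` (`c′ = 1`) -/
def tdeg (d k : ℕ) : ℕ := k * (d - 2) - 2

/-- every target basis monomial is hit by a column that is exactly that unit vector (⇒ rank = dim B_{t-d}, paper step) -/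
def covered (d k : ℕ) : Bool :=
  (basisL d k (tdeg d k)).all (fun v => (basisL d k (sdeg d k)).any (fun m => suppMulL d m == [v]))

/-- and every column is a unit vector or zero -/
def unitColumns (d k : ℕ) : Bool :=
  (basisL d k (sdeg d k)).all (fun m => (suppMulL d m).length ≤ 1)

/-- finite re-evaluation (`decide`): `k′ ∈ {3,4}`, `d = 5..8` — the target basis is covered by unit columns and every column is a unit vector or zero. -/
theorem covered_table : ∀ k ∈ [3, 4], ∀ d ∈ List.range' 5 4, covered d k = true ∧ unitColumns d k = true := by decide

/-- the exceptional `k′ = 2` is NOT covered for d = 5..9 (the monomial x₁^{d-3}x₂^{d-3} is never hit; for d ≥ 6 this is the jump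
ρ = 2 < 3 = H_min of anchor 3, while at d = 5 H_min = H_B(d) = 2 is attained anyway) -/
theorem k2_table : ∀ d ∈ List.range' 5 5, covered d 2 = false := by decide

/-- dimensions: dim B_{t-d} = k(k+1)/2 for d ≥ 5 (here k = 3,4; d = 5..8) -/
theorem tdim_table : ∀ k ∈ [3, 4], ∀ d ∈ List.range' 5 4, (basisL d k (tdeg d k)).length = k * (k + 1) / 2 := by decide

/-- ALL d ≥ 5, k′ = 3: the column of a source monomial with first exponent 0 is the unit vector obtained by raising that exponent to d-2. -/
theorem suppMulL_zero_first (d j l : ℕ) (hj : 1 ≤ j) (hl : 1 ≤ l) :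
    suppMulL d [0, j, l] = [[d - 2, j, l]] := by
  have hj' : j ≠ 0 := by omega
  have hl' : l ≠ 0 := by omega
  simp [suppMulL, List.range, List.range.loop, List.getD, hj', hl']

/-- … second exponent 0 … -/
theorem suppMulL_zero_second (d i l : ℕ) (hi : 1 ≤ i) (hl : 1 ≤ l) :
    suppMulL d [i, 0, l] = [[i, d - 2, l]] := by
  have hi' : i ≠ 0 := by omega
  have hl' : l ≠ 0 := by omega
  simp [suppMulL, List.range, List.range.loop, List.getD, hi', hl']

/-- … third exponent 0 … -/
theorem suppMulL_zero_third (d i j : ℕ) (hi : 1 ≤ i) (hj : 1 ≤ j) :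
    suppMulL d [i, j, 0] = [[i, j, d - 2]] := by
  have hi' : i ≠ 0 := by omega
  have hj' : j ≠ 0 := by omega
  simp [suppMulL, List.range, List.range.loop, List.getD, hi', hj']

/-- … and a source monomial with no zero exponent has the zero column. -/
theorem suppMulL_nozero (d i j l : ℕ) (hi : 1 ≤ i) (hj : 1 ≤ j) (hl : 1 ≤ l) :
    suppMulL d [i, j, l] = [] := by
  have hi' : i ≠ 0 := by omega
  have hj' : j ≠ 0 := by omega
  have hl' : l ≠ 0 := by omega
  simp [suppMulL, List.range, List.range.loop, List.getD, hi', hj', hl']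

/-- ALL d ≥ 5, k′ = 3: a source monomial (entries ≤ d-2, degree 2d-6) has AT MOST ONE zero exponent, and then the other two are ≥ d-4 ≥ 1;
a target monomial (entries ≤ d-2, degree 3d-8) has some exponent equal to d-2 and the other two are ≥ d-4 ≥ 1 and sum to 2d-6.
(Pure arithmetic; with the four lemmas above: every target monomial v with v_i = d-2 is the unit column of the source monomial v - (d-2)e_i,
and all other columns vanish ⇒ ρ = dim B_{3d-8} = 6 = H_min for every d ≥ 5 in the cells (6,d,2) — paper step.) -/
theorem source_target_shape (d i j l : ℕ) (hd : 5 ≤ d) :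
    ((i ≤ d - 2 ∧ j ≤ d - 2 ∧ l ≤ d - 2 ∧ i + j + l = 2 * d - 6) →
      ((i = 0 → 1 ≤ j ∧ 1 ≤ l) ∧ (j = 0 → 1 ≤ i ∧ 1 ≤ l) ∧ (l = 0 → 1 ≤ i ∧ 1 ≤ j))) ∧
    ((i ≤ d - 2 ∧ j ≤ d - 2 ∧ l ≤ d - 2 ∧ i + j + l = 3 * d - 8) →
      ((i = d - 2 ∨ j = d - 2 ∨ l = d - 2) ∧ d - 4 ≤ i ∧ d - 4 ≤ j ∧ d - 4 ≤ l)) := by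
  constructor
  · intro h; refine ⟨?_, ?_, ?_⟩ <;> intro h' <;> constructor <;> omega
  · intro h; refine ⟨by omega, by omega, by omega, by omega⟩

end Summit.HodgeConjecture.HodgeConjecture.HodgeLocus.Census.ModelNonJumpC1
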